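import Literature.Analysis.FluidPDE.HardSpherePhaseSpace
import HarnessLib

/-!
# Regular hard-sphere geometries: the local structure of contact configurations

Second layer of the plan for Alexander's theorem (`Kinetic.HardSphereFlow.nonempty_torus`, see
`Literature.Analysis.FluidPDE.HardSphereFlowConstruction`): the deterministic part of the
construction of the hard-sphere flow (CIP 1994 §4.2, App. 4.A; GST 2013 §4.1) uses exactly four
properties of the position space, which hold both on `ℝ^d` and on the flat torus `T^d` with
spheres of diameter `ε < 1/2`. We isolate them as a `Prop`-valued structure on a
`Kinetic.Geometry` and derive the local behaviour of a pair of spheres near contact under free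
flight — the elementary geometry behind "collisions are isolated", "an outgoing pair separates",
"an incoming pair is about to overlap", "the pair `(i, j)` and the pair `(j, i)` collide in the
same way".

* `Kinetic.Geometry.IsHardSphereRegular G ε` — translation `(x, v) ↦ x + v` is continuous; the
  separation distance `(x, y) ↦ |x - y|` is continuous; the separation vector is odd,
  `sep(y, x) = -sep(x, y)`, whenever `|sep(x, y)| ≤ ε`; and it is *locally linear* near such
  pairs: `sep(x + v, y + w) = sep(x, y) + (v - w)` for `|v|, |w| < δ` (some `δ > 0` depending on
  `G, ε` only). On `T^d` this is the statement that for `ε < 1/2` the minimal image of a pair at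
  distance `≤ ε` is locally constant (GST 2013 Ch. 4 intro; this is why `nonempty_torus` assumes
  `ε < 1/2`).
* `Euclidean.isHardSphereRegular_geometry` (every `ε`), `Torus.isHardSphereRegular_geometry`
  (`ε < 1/2`, with `δ = (1/2 - ε)/2`) — both proved, via the torus lemmas `Torus.reprSym_neg`,
  `Torus.reprSym_add_proj` (the symmetric representative is odd and additive away from the cut
  locus) and `Torus.continuous_norm_reprSym`.
* consequences for a regular geometry (namespace `Kinetic.Geometry.IsHardSphereRegular`):
  continuity of free flight, closedness of the hard-sphere domain and of the contact sets,
  symmetry in `(i, j)` of `contactSet`, `IsIncoming`, `IsOutgoing`, `IsGrazing` and `collidePair`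
  at contact, the expansion `|x_i - x_j|²(t) = |n|² + 2t ⟪n, v_i - v_j⟫ + t² |v_i - v_j|²` of the
  pair distance along free flight near a configuration with `|n| ≤ ε` (GST 2013 §4.1, CIP 1994
  §4.2: the sign of `n · (v_i - v_j)` decides between pre- and post-collisional), and its
  qualitative corollaries: an outgoing or grazing contact pair does not overlap for small
  positive times, an incoming one does, a separated pair stays separated; hence a configuration
  of the domain none of whose contact pairs is incoming stays in the domain for a while
  (`eventually_freeFlight_mem`), and one with an incoming contact pair leaves it immediately
  (`eventually_freeFlight_not_mem`).

## Mathlib / Literature reuse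

`AddCircle.equivIoc`, `AddCircle.equivIoc_coe_eq`, `PiLp.norm_apply_le`, `norm_add_sq_real`,
`Filter.eventually_all` are Mathlib's; `Torus.reprSym`, `Torus.proj`, `Kinetic.reflectVel_smul`,
`Kinetic.collidePair_apply_*` are the Literature files'. Nothing here duplicates Mathlib (there
is no minimal-image / periodic-distance API in Mathlib beyond the norm on `AddCircle`).

## References

* C. Cercignani, R. Illner, M. Pulvirenti, *The Mathematical Theory of Dilute Gases* (1994),
  §4.2 (ingoing / outgoing / grazing configurations), App. 4.A (the torus case).
* I. Gallagher, L. Saint-Raymond, B. Texier, *From Newton to Boltzmann* (2013), Ch. 4 intro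
  (hard spheres on `T^d`, minimal image), §4.1 (pre- and post-collisional velocities).
-/

open Set Filter Topology
open scoped InnerProductSpace

namespace Literature.Analysis.FluidPDE

noncomputable section

/-! ## The symmetric representative on the torus away from the cut locus -/

namespace Torus

variable {d : Type*}

/-- The symmetric representative projects back coordinatewise: `↑(reprSym x i) = x i`. [folklore] -/
theorem coe_reprSym_apply (x : UnitAddTorus d) (i : d) :
    ((reprSym x i : ℝ) : UnitAddCircle) = x i := by
  rw [reprSym_apply]
  exact AddCircle.coe_equivIoc

/-- A real number of `(-1/2, 1/2]` is its own symmetric representative modulo `1`. [folklore] -/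
theorem equivIoc_coe_of_mem {a : ℝ} (ha : a ∈ Ioc (-(1 / 2 : ℝ)) (1 / 2)) :
    ((AddCircle.equivIoc (1 : ℝ) (-(1 / 2 : ℝ)) (a : UnitAddCircle) : ℝ)) = a := by
  have ha' : a ∈ Ioc (-(1 / 2 : ℝ)) (-(1 / 2 : ℝ) + 1) := ⟨ha.1, by linarith [ha.2]⟩
  rw [AddCircle.equivIoc_coe_eq ha']

/-- Away from the cut locus the symmetric representative is odd: if every coordinate of
`reprSym x` lies in the open cube `(-1/2, 1/2)` then `reprSym (-x) = -reprSym x`. [folklore] -/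
theorem reprSym_neg {x : UnitAddTorus d} (hx : ∀ i, |reprSym x i| < 1 / 2) :
    reprSym (-x) = -reprSym x := by
  ext i
  have h := abs_lt.1 (hx i)
  have hxi : (-x) i = ((-(reprSym x i) : ℝ) : UnitAddCircle) := by
    rw [Pi.neg_apply, AddCircle.coe_neg, coe_reprSym_apply]
  rw [reprSym_apply, hxi, equivIoc_coe_of_mem ⟨by linarith [h.2], by linarith [h.1]⟩]
  simp

/-- Away from the cut locus the symmetric representative is additive along the covering map: if
every coordinate of `reprSym x + s` lies in `(-1/2, 1/2]` then `reprSym (x + proj s) = reprSym x + s`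
(the minimal image is locally constant; GST 2013 Ch. 4 intro). [folklore] -/
theorem reprSym_add_proj {x : UnitAddTorus d} {s : EuclideanSpace ℝ d}
    (h : ∀ i, reprSym x i + s i ∈ Ioc (-(1 / 2 : ℝ)) (1 / 2)) :
    reprSym (x + FunctionSpaces.Torus.proj s) = reprSym x + s := by
  ext i
  have hxi : (x + FunctionSpaces.Torus.proj s) i = ((reprSym x i + s i : ℝ) : UnitAddCircle) := by
    rw [Pi.add_apply, FunctionSpaces.Torus.proj_apply, AddCircle.coe_add, coe_reprSym_apply]
  rw [reprSym_apply, hxi, equivIoc_coe_of_mem (h i)]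
  simp

variable [Fintype d]

/-- Each coordinate of the symmetric representative is bounded by its Euclidean norm. [folklore] -/
theorem abs_reprSym_apply_le_norm (x : UnitAddTorus d) (i : d) : |reprSym x i| ≤ ‖reprSym x‖ := by
  simpa using PiLp.norm_apply_le (reprSym x) i

/-- The minimal-image norm `x ↦ ‖reprSym x‖ = (∑ ‖x i‖²)^{1/2}` is continuous on the torus (even
though `reprSym` itself is not). [folklore] -/
theorem continuous_norm_reprSym : Continuous fun x : UnitAddTorus d => ‖reprSym x‖ := by
  have h : (fun x : UnitAddTorus d => ‖reprSym x‖) = fun x => Real.sqrt (∑ i, ‖x i‖ ^ 2) := by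
    funext x
    rw [EuclideanSpace.norm_eq]
    congr 1
    refine Finset.sum_congr rfl fun i _ => ?_
    rw [Real.norm_eq_abs, abs_reprSym_apply]
  rw [h]
  exact Real.continuous_sqrt.comp
    (continuous_finsetSum _ fun i _ => ((continuous_apply i).norm).pow 2)

/-- The minimal-image distance is jointly continuous. [folklore] -/
theorem continuous_euclidDist :
    Continuous fun p : UnitAddTorus d × UnitAddTorus d => euclidDist p.1 p.2 :=
  continuous_norm_reprSym.comp (continuous_fst.sub continuous_snd)

end Torus

section Kinetic

variable {d : Type*} [Fintype d] {X : Type*} {N : ℕ}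

/-! ## Two identities of the reflection law -/

section Reflect

variable {E : Type*} [NormedAddCommGroup E] [InnerProductSpace ℝ E]

/-- The reflection law is even in the impact direction: `reflectVel (-n) = reflectVel n`. [folklore] -/
theorem reflectVel_neg (n : E) (p : E × E) : reflectVel (-n) p = reflectVel n p := by
  simpa using reflectVel_smul (c := (-1 : ℝ)) (by norm_num) n p

/-- The reflection law is symmetric under exchange of the two particles. [folklore] -/
theorem reflectVel_swap (n : E) (p : E × E) :
    reflectVel n (p.2, p.1) = ((reflectVel n p).2, (reflectVel n p).1) := by
  have h : ⟪p.2 - p.1, n⟫_ℝ = -⟪p.1 - p.2, n⟫_ℝ := by rw [← neg_sub p.1 p.2, inner_neg_left]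
  simp only [reflectVel, h, neg_div, neg_smul, sub_neg_eq_add, ← sub_eq_add_neg]

end Reflect

/-! ## Regular geometries -/

/-- A geometry `G` is *hard-sphere regular at diameter `ε`* if it has the four properties of
`ℝ^d` and of `T^d` (with `ε < 1/2`) that the construction of the hard-sphere flow uses
(CIP 1994 §4.2 and App. 4.A treat `Λ ⊆ ℝ³` and the 3-torus alike; GST 2013 Ch. 4 intro: "the
case of the torus is identical up to the minimal-image convention"): translation is jointly
continuous; the separation distance is jointly continuous; the separation vector is odd on pairs
at distance `≤ ε`; and near such pairs it is locally linear under small translations, uniformly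
(`δ` depends on `G, ε` only). [cite: GST2013, Ch. 4 intro] -/
structure Geometry.IsHardSphereRegular [TopologicalSpace X] (G : Geometry d X) (ε : ℝ) : Prop where
  /-- `(x, v) ↦ x + v` is continuous. -/
  continuous_translate : Continuous fun p : X × EuclideanSpace ℝ d => G.translate p.1 p.2
  /-- `(x, y) ↦ |x - y|` is continuous. -/
  continuous_norm_sepVec : Continuous fun p : X × X => ‖G.sepVec p.1 p.2‖
  /-- `y - x = -(x - y)` for pairs at distance at most `ε`. -/
  sepVec_comm : ∀ x y : X, ‖G.sepVec x y‖ ≤ ε → G.sepVec y x = -G.sepVec x y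
  /-- `(x + v) - (y + w) = (x - y) + (v - w)` for pairs at distance at most `ε` and small `v, w`. -/
  exists_sepVec_translate : ∃ δ : ℝ, 0 < δ ∧ ∀ (x y : X) (v w : EuclideanSpace ℝ d),
    ‖G.sepVec x y‖ ≤ ε → ‖v‖ < δ → ‖w‖ < δ →
      G.sepVec (G.translate x v) (G.translate y w) = G.sepVec x y + (v - w)

end Kinetic

/-- The whole-space geometry `ℝ^d` is hard-sphere regular at every diameter (all four properties
are identities of the vector space). [folklore] -/
theorem Euclidean.isHardSphereRegular_geometry {d : Type*} [Fintype d] (ε : ℝ) :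
    (Euclidean.geometry d).IsHardSphereRegular ε where
  continuous_translate := continuous_fst.add continuous_snd
  continuous_norm_sepVec := (continuous_fst.sub continuous_snd).norm
  sepVec_comm x y _ := (neg_sub x y).symm
  exists_sepVec_translate := ⟨1, one_pos, fun x y v w _ _ _ => by
    simp only [Euclidean.geometry_translate, Euclidean.geometry_sepVec]
    abel⟩

/-- The flat torus `T^d` with the minimal-image separation is hard-sphere regular at every
diameter `ε < 1/2`, with `δ = (1/2 - ε)/2`: a pair at minimal-image distance `≤ ε` has all
coordinates of its separation vector in `[-ε, ε]`, so translating both points by less than `δ`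
keeps them inside the open cube `(-1/2, 1/2)^d`, where `reprSym` is odd and additive
(GST 2013 Ch. 4 intro; this is the role of the hypothesis `ε < 1/2` in
`Kinetic.HardSphereFlow.nonempty_torus`). [cite: GST2013, Ch. 4 intro] -/
theorem Torus.isHardSphereRegular_geometry {d : Type*} [Fintype d] {ε : ℝ} (hε : ε < 2⁻¹) :
    (Torus.geometry d).IsHardSphereRegular ε where
  continuous_translate := by
    change Continuous fun p : UnitAddTorus d × EuclideanSpace ℝ d => p.1 + FunctionSpaces.Torus.proj p.2
    exact continuous_fst.add (FunctionSpaces.Torus.continuous_proj.comp continuous_snd)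
  continuous_norm_sepVec := Torus.continuous_norm_reprSym.comp (continuous_fst.sub continuous_snd)
  sepVec_comm x y hxy := by
    change Torus.reprSym (y - x) = -Torus.reprSym (x - y)
    rw [← neg_sub x y]
    refine Torus.reprSym_neg fun i => ?_
    calc |Torus.reprSym (x - y) i| ≤ ‖Torus.reprSym (x - y)‖ := Torus.abs_reprSym_apply_le_norm _ i
      _ ≤ ε := hxy
      _ < 1 / 2 := by norm_num at hε ⊢; exact hε
  exists_sepVec_translate := by
    refine ⟨(2⁻¹ - ε) / 2, by linarith, fun x y v w hxy hv hw => ?_⟩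
    change Torus.reprSym (x + FunctionSpaces.Torus.proj v - (y + FunctionSpaces.Torus.proj w)) = Torus.reprSym (x - y) + (v - w)
    have hxy' : x + FunctionSpaces.Torus.proj v - (y + FunctionSpaces.Torus.proj w) = (x - y) + FunctionSpaces.Torus.proj (v - w) := by
      rw [sub_eq_add_neg v w, FunctionSpaces.Torus.proj_add, FunctionSpaces.Torus.proj_neg]
      abel
    rw [hxy']
    refine Torus.reprSym_add_proj fun i => ?_
    have h1 : |Torus.reprSym (x - y) i| ≤ ε := (Torus.abs_reprSym_apply_le_norm _ i).trans hxy
    have h2 : |(v - w) i| < 2⁻¹ - ε := by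
      calc |(v - w) i| ≤ ‖v - w‖ := by simpa using PiLp.norm_apply_le (v - w) i
        _ ≤ ‖v‖ + ‖w‖ := norm_sub_le v w
        _ < 2⁻¹ - ε := by linarith
    rw [abs_le] at h1
    rw [abs_lt] at h2
    have h22 : (2⁻¹ : ℝ) = 1 / 2 := by norm_num
    constructor <;> linarith [h1.1, h1.2, h2.1, h2.2]

section Kinetic

variable {d : Type*} [Fintype d] {X : Type*} {N : ℕ}

namespace Geometry.IsHardSphereRegular

variable [TopologicalSpace X] {G : Geometry d X} {ε : ℝ}

/-! ## Continuity and closedness -/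

/-- Free flight is jointly continuous in time and initial datum. [folklore] -/
theorem continuous_freeFlight₂ (hG : G.IsHardSphereRegular ε) :
    Continuous fun p : ℝ × Config N d X => freeFlight G p.1 p.2 := by
  have htr := hG.continuous_translate
  unfold freeFlight
  fun_prop

/-- The free-flight orbit of a datum is continuous in time. [folklore] -/
theorem continuous_freeFlight (hG : G.IsHardSphereRegular ε) (z : Config N d X) :
    Continuous fun t : ℝ => freeFlight G t z := by
  have h := hG.continuous_freeFlight₂ (N := N)
  fun_prop

/-- Each free-flight map is continuous in the datum. [folklore] -/
theorem continuous_freeFlight_right (hG : G.IsHardSphereRegular ε) (t : ℝ) :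
    Continuous (freeFlight (N := N) G t) := by
  have h := hG.continuous_freeFlight₂ (N := N)
  change Continuous fun z : Config N d X => freeFlight G t z
  fun_prop

/-- The distance of the pair `(i, j)` is a continuous function of the configuration. [folklore] -/
theorem continuous_norm_sepVec_config (hG : G.IsHardSphereRegular ε) (i j : Fin N) :
    Continuous fun z : Config N d X => ‖G.sepVec (z i).1 (z j).1‖ := by
  -- (elaborating `hG.continuous_norm_sepVec.comp _` against the goal directly makes the unifier
  -- unfold the phase-space abbreviation and time out; go through `Function.comp_def` instead)
  have h2 : Continuous fun z : Config N d X => ((z i).1, (z j).1) := by fun_prop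
  simpa only [Function.comp_def] using hG.continuous_norm_sepVec.comp h2

/-- The hard-sphere domain of a regular geometry is closed. [folklore] -/
theorem isClosed_hardSphereDomain (hG : G.IsHardSphereRegular ε) :
    IsClosed (hardSphereDomain G N ε) := by
  have h : hardSphereDomain G N ε =
      ⋂ i, ⋂ j, {z : Config N d X | i ≠ j → ε ≤ ‖G.sepVec (z i).1 (z j).1‖} := by
    ext z
    simp [mem_hardSphereDomain]
  rw [h]
  refine isClosed_iInter fun i => isClosed_iInter fun j => ?_
  by_cases hij : i = j
  · simp [hij]
  simp only [ne_eq, hij, not_false_eq_true, forall_const]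
  exact isClosed_le continuous_const (hG.continuous_norm_sepVec_config i j)

/-- The contact sets of a regular geometry are closed. [folklore] -/
theorem isClosed_contactSet (hG : G.IsHardSphereRegular ε) (i j : Fin N) :
    IsClosed (contactSet G N ε i j) :=
  hG.isClosed_hardSphereDomain.inter
    (isClosed_eq (hG.continuous_norm_sepVec_config i j) continuous_const)

/-! ## Symmetry in the pair at contact -/

/-- At distance `≤ ε` the separation distance is symmetric. [folklore] -/
theorem norm_sepVec_comm_of_le (hG : G.IsHardSphereRegular ε) {x y : X} (h : ‖G.sepVec x y‖ ≤ ε) :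
    ‖G.sepVec y x‖ = ‖G.sepVec x y‖ := by
  rw [hG.sepVec_comm x y h, norm_neg]

/-- Contact sets are symmetric in the pair. [folklore] -/
theorem mem_contactSet_comm (hG : G.IsHardSphereRegular ε) {z : Config N d X} {i j : Fin N} :
    z ∈ contactSet G N ε i j ↔ z ∈ contactSet G N ε j i := by
  constructor <;> rintro ⟨hD, h⟩ <;> exact ⟨hD, by rw [hG.norm_sepVec_comm_of_le h.le, h]⟩

/-- At distance `≤ ε`, "incoming" is symmetric in the pair. [folklore] -/
theorem isIncoming_comm (hG : G.IsHardSphereRegular ε) {z : Config N d X} {i j : Fin N}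
    (h : ‖G.sepVec (z i).1 (z j).1‖ ≤ ε) : IsIncoming G z j i ↔ IsIncoming G z i j := by
  unfold IsIncoming
  rw [hG.sepVec_comm _ _ h, inner_neg_left, ← inner_neg_right, neg_sub]

/-- At distance `≤ ε`, "outgoing" is symmetric in the pair. [folklore] -/
theorem isOutgoing_comm (hG : G.IsHardSphereRegular ε) {z : Config N d X} {i j : Fin N}
    (h : ‖G.sepVec (z i).1 (z j).1‖ ≤ ε) : IsOutgoing G z j i ↔ IsOutgoing G z i j := by
  unfold IsOutgoing
  rw [hG.sepVec_comm _ _ h, inner_neg_left, ← inner_neg_right, neg_sub]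

/-- At distance `≤ ε`, "grazing" is symmetric in the pair. [folklore] -/
theorem isGrazing_comm (hG : G.IsHardSphereRegular ε) {z : Config N d X} {i j : Fin N}
    (h : ‖G.sepVec (z i).1 (z j).1‖ ≤ ε) : IsGrazing G z j i ↔ IsGrazing G z i j := by
  unfold IsGrazing
  rw [hG.sepVec_comm _ _ h, inner_neg_left, ← inner_neg_right, neg_sub]

/-- At distance `≤ ε`, the elastic collision of `(j, i)` is that of `(i, j)`. [folklore] -/
theorem collidePair_comm (hG : G.IsHardSphereRegular ε) {z : Config N d X} {i j : Fin N}
    (hij : i ≠ j) (h : ‖G.sepVec (z i).1 (z j).1‖ ≤ ε) :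
    collidePair G j i z = collidePair G i j z := by
  have hR : reflectVel (G.sepVec (z j).1 (z i).1) ((z j).2, (z i).2) =
      ((reflectVel (G.sepVec (z i).1 (z j).1) ((z i).2, (z j).2)).2,
        (reflectVel (G.sepVec (z i).1 (z j).1) ((z i).2, (z j).2)).1) := by
    rw [hG.sepVec_comm _ _ h, reflectVel_neg]
    exact reflectVel_swap _ ((z i).2, (z j).2)
  funext k
  by_cases hki : k = i
  · subst hki
    rw [collidePair_apply_right, collidePair_apply_left hij, hR]
  by_cases hkj : k = j
  · subst hkj
    rw [collidePair_apply_left (Ne.symm hij), collidePair_apply_right, hR]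
  rw [collidePair_apply_of_ne hkj hki, collidePair_apply_of_ne hki hkj]

/-! ## A pair near contact under free flight -/

/-- Local linearity of the separation vector along free flight: near a configuration where the
pair `(i, j)` is at distance `≤ ε`, `x_i(t) - x_j(t) = n + t (v_i - v_j)` for small `|t|`. [folklore] -/
theorem eventually_sepVec_freeFlight (hG : G.IsHardSphereRegular ε) {z : Config N d X}
    {i j : Fin N} (h : ‖G.sepVec (z i).1 (z j).1‖ ≤ ε) :
    ∀ᶠ t : ℝ in 𝓝 0, G.sepVec (freeFlight G t z i).1 (freeFlight G t z j).1 =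
      G.sepVec (z i).1 (z j).1 + t • ((z i).2 - (z j).2) := by
  obtain ⟨δ, hδ, hlin⟩ := hG.exists_sepVec_translate
  have hsmall : ∀ v : EuclideanSpace ℝ d, ∀ᶠ t : ℝ in 𝓝 0, ‖t • v‖ < δ := fun v => by
    have hc : Continuous fun t : ℝ => ‖t • v‖ := (continuous_id.smul continuous_const).norm
    have ht := hc.tendsto 0
    simp only [zero_smul, norm_zero] at ht
    exact ht.eventually (gt_mem_nhds hδ)
  filter_upwards [hsmall (z i).2, hsmall (z j).2] with t hti htj
  rw [freeFlight_apply, freeFlight_apply, hlin _ _ _ _ h hti htj, smul_sub]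

/-- The pair distance along free flight is locally an explicit quadratic polynomial:
`|x_i(t) - x_j(t)|² = |n|² + 2t ⟪n, v_i - v_j⟫ + t² |v_i - v_j|²` for small `|t|`
(GST 2013 §4.1; CIP 1994 §4.2). [cite: GST2013, §4.1] -/
theorem eventually_norm_sq_sepVec_freeFlight (hG : G.IsHardSphereRegular ε) {z : Config N d X}
    {i j : Fin N} (h : ‖G.sepVec (z i).1 (z j).1‖ ≤ ε) :
    ∀ᶠ t : ℝ in 𝓝 0, ‖G.sepVec (freeFlight G t z i).1 (freeFlight G t z j).1‖ ^ 2 =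
      ‖G.sepVec (z i).1 (z j).1‖ ^ 2 + 2 * t * ⟪G.sepVec (z i).1 (z j).1, (z i).2 - (z j).2⟫_ℝ +
        t ^ 2 * ‖(z i).2 - (z j).2‖ ^ 2 := by
  filter_upwards [hG.eventually_sepVec_freeFlight h] with t ht
  rw [ht, norm_add_sq_real, norm_smul, inner_smul_right, Real.norm_eq_abs, mul_pow, sq_abs]
  ring

/-- An outgoing or grazing contact pair does not overlap for small nonnegative times:
`ε ≤ |x_i(t) - x_j(t)|` eventually in `t → 0⁺` (in fact for all small `|t|` if grazing). [folklore] -/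
theorem eventually_le_norm_sepVec_freeFlight_of_not_isIncoming (hG : G.IsHardSphereRegular ε)
    {z : Config N d X} {i j : Fin N} (hc : ‖G.sepVec (z i).1 (z j).1‖ = ε)
    (hin : ¬IsIncoming G z i j) :
    ∀ᶠ t : ℝ in 𝓝[≥] 0, ε ≤ ‖G.sepVec (freeFlight G t z i).1 (freeFlight G t z j).1‖ := by
  have hε : 0 ≤ ε := hc ▸ norm_nonneg _
  have hin' : 0 ≤ ⟪G.sepVec (z i).1 (z j).1, (z i).2 - (z j).2⟫_ℝ := not_lt.1 hin
  have h := hG.eventually_norm_sq_sepVec_freeFlight hc.le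
  rw [hc] at h
  filter_upwards [mem_nhdsWithin_of_mem_nhds h, self_mem_nhdsWithin] with t ht (ht0 : 0 ≤ t)
  refine (sq_le_sq₀ hε (norm_nonneg _)).1 ?_
  rw [ht]
  nlinarith [sq_nonneg t, sq_nonneg ‖(z i).2 - (z j).2‖, mul_nonneg ht0 hin']

/-- A grazing contact pair does not overlap for small times of either sign:
`ε ≤ |x_i(t) - x_j(t)|` for all small `|t|` (`|n + t u|² = ε² + t²|u|²`). [folklore] -/
theorem eventually_le_norm_sepVec_freeFlight_of_isGrazing (hG : G.IsHardSphereRegular ε)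
    {z : Config N d X} {i j : Fin N} (hc : ‖G.sepVec (z i).1 (z j).1‖ = ε)
    (hgr : IsGrazing G z i j) :
    ∀ᶠ t : ℝ in 𝓝 0, ε ≤ ‖G.sepVec (freeFlight G t z i).1 (freeFlight G t z j).1‖ := by
  have hε : 0 ≤ ε := hc ▸ norm_nonneg _
  have h := hG.eventually_norm_sq_sepVec_freeFlight hc.le
  rw [hc] at h
  filter_upwards [h] with t ht
  refine (sq_le_sq₀ hε (norm_nonneg _)).1 ?_
  rw [ht, hgr]
  nlinarith [sq_nonneg t, sq_nonneg ‖(z i).2 - (z j).2‖]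

/-- An outgoing contact pair separates strictly for small positive times:
`ε < |x_i(t) - x_j(t)|` eventually in `t → 0⁺`, `t > 0`. [folklore] -/
theorem eventually_lt_norm_sepVec_freeFlight_of_isOutgoing (hG : G.IsHardSphereRegular ε)
    {z : Config N d X} {i j : Fin N} (hc : ‖G.sepVec (z i).1 (z j).1‖ = ε)
    (hout : IsOutgoing G z i j) :
    ∀ᶠ t : ℝ in 𝓝[>] 0, ε < ‖G.sepVec (freeFlight G t z i).1 (freeFlight G t z j).1‖ := by
  have hε : 0 ≤ ε := hc ▸ norm_nonneg _
  have h := hG.eventually_norm_sq_sepVec_freeFlight hc.le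
  rw [hc] at h
  filter_upwards [mem_nhdsWithin_of_mem_nhds h, self_mem_nhdsWithin] with t ht (ht0 : 0 < t)
  refine (sq_lt_sq₀ hε (norm_nonneg _)).1 ?_
  rw [ht]
  have : 0 < ⟪G.sepVec (z i).1 (z j).1, (z i).2 - (z j).2⟫_ℝ := hout
  nlinarith [sq_nonneg t, sq_nonneg ‖(z i).2 - (z j).2‖, mul_pos ht0 this]

/-- An incoming contact pair overlaps for small positive times: `|x_i(t) - x_j(t)| < ε`
eventually in `t → 0⁺`, `t > 0` — the free flight leaves the hard-sphere domain, which is why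
the reflection law must be applied (CIP 1994 §4.2). [folklore] -/
theorem eventually_norm_sepVec_freeFlight_lt_of_isIncoming (hG : G.IsHardSphereRegular ε)
    {z : Config N d X} {i j : Fin N} (hc : ‖G.sepVec (z i).1 (z j).1‖ = ε)
    (hin : IsIncoming G z i j) :
    ∀ᶠ t : ℝ in 𝓝[>] 0, ‖G.sepVec (freeFlight G t z i).1 (freeFlight G t z j).1‖ < ε := by
  have hε : 0 ≤ ε := hc ▸ norm_nonneg _
  set a : ℝ := ⟪G.sepVec (z i).1 (z j).1, (z i).2 - (z j).2⟫_ℝ with ha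
  set b : ℝ := ‖(z i).2 - (z j).2‖ ^ 2 with hb
  have ha0 : a < 0 := hin
  -- the linear factor `2a + t b` is negative at `t = 0`, hence for small `t`
  have hlin : ∀ᶠ t : ℝ in 𝓝 0, 2 * a + t * b < 0 := by
    have hc' : Continuous fun t : ℝ => 2 * a + t * b := by fun_prop
    have := hc'.tendsto 0
    simp only [zero_mul, add_zero] at this
    exact this.eventually (gt_mem_nhds (show 2 * a < 0 by linarith))
  have h := hG.eventually_norm_sq_sepVec_freeFlight hc.le
  rw [hc] at h
  filter_upwards [mem_nhdsWithin_of_mem_nhds h, mem_nhdsWithin_of_mem_nhds hlin,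
    self_mem_nhdsWithin] with t ht hlt (ht0 : 0 < t)
  refine (sq_lt_sq₀ (norm_nonneg _) hε).1 ?_
  rw [ht]
  nlinarith [mul_neg_of_pos_of_neg ht0 hlt]

/-- Symmetrically, an incoming contact pair was strictly separated at small negative times. [folklore] -/
theorem eventually_lt_norm_sepVec_freeFlight_of_isIncoming (hG : G.IsHardSphereRegular ε)
    {z : Config N d X} {i j : Fin N} (hc : ‖G.sepVec (z i).1 (z j).1‖ = ε)
    (hin : IsIncoming G z i j) :
    ∀ᶠ t : ℝ in 𝓝[<] 0, ε < ‖G.sepVec (freeFlight G t z i).1 (freeFlight G t z j).1‖ := by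
  have hε : 0 ≤ ε := hc ▸ norm_nonneg _
  have h := hG.eventually_norm_sq_sepVec_freeFlight hc.le
  rw [hc] at h
  filter_upwards [mem_nhdsWithin_of_mem_nhds h, self_mem_nhdsWithin] with t ht (ht0 : t < 0)
  refine (sq_lt_sq₀ hε (norm_nonneg _)).1 ?_
  rw [ht]
  have : ⟪G.sepVec (z i).1 (z j).1, (z i).2 - (z j).2⟫_ℝ < 0 := hin
  nlinarith [sq_nonneg t, sq_nonneg ‖(z i).2 - (z j).2‖, mul_pos_of_neg_of_neg ht0 this]

/-- A separated pair (`ε < |x_i - x_j|`) stays separated for small times. [folklore] -/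
theorem eventually_lt_norm_sepVec_freeFlight_of_lt (hG : G.IsHardSphereRegular ε)
    {z : Config N d X} {i j : Fin N} (h : ε < ‖G.sepVec (z i).1 (z j).1‖) :
    ∀ᶠ t : ℝ in 𝓝 0, ε < ‖G.sepVec (freeFlight G t z i).1 (freeFlight G t z j).1‖ := by
  have hc : Continuous fun t : ℝ => ‖G.sepVec (freeFlight G t z i).1 (freeFlight G t z j).1‖ := by
    simpa only [Function.comp_def] using
      (hG.continuous_norm_sepVec_config i j).comp (hG.continuous_freeFlight z)
  have ht := hc.tendsto 0
  simp only [freeFlight_zero] at ht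
  exact ht.eventually (lt_mem_nhds h)

/-- **No incoming contact pair ⇒ the free flight stays in the domain for a while.** If
`z ∈ D_ε^N` and none of its contact pairs is incoming (each is outgoing or grazing), then
`S_t z ∈ D_ε^N` for all small `t ≥ 0` (finitely many pairs, each handled by the lemmas above).
In the construction of the flow this gives `τ(z) > 0` for post-collisional configurations. [folklore] -/
theorem eventually_freeFlight_mem (hG : G.IsHardSphereRegular ε) {z : Config N d X}
    (hz : z ∈ hardSphereDomain G N ε)
    (h : ∀ i j : Fin N, i ≠ j → z ∈ contactSet G N ε i j → ¬IsIncoming G z i j) :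
    ∀ᶠ t : ℝ in 𝓝[≥] 0, freeFlight G t z ∈ hardSphereDomain G N ε := by
  have hpair : ∀ p : Fin N × Fin N, ∀ᶠ t : ℝ in 𝓝[≥] 0, p.1 ≠ p.2 →
      ε ≤ ‖G.sepVec (freeFlight G t z p.1).1 (freeFlight G t z p.2).1‖ := by
    rintro ⟨i, j⟩
    by_cases hij : i = j
    · exact Eventually.of_forall fun t h' => (h' hij).elim
    have hle : ε ≤ ‖G.sepVec (z i).1 (z j).1‖ := hz i j hij
    rcases hle.eq_or_lt with hc | hlt
    · exact (hG.eventually_le_norm_sepVec_freeFlight_of_not_isIncoming hc.symm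
        (h i j hij ⟨hz, hc.symm⟩)).mono fun t ht _ => ht
    · exact ((hG.eventually_lt_norm_sepVec_freeFlight_of_lt hlt).filter_mono
        nhdsWithin_le_nhds).mono fun t ht _ => le_of_lt ht
  filter_upwards [eventually_all.2 hpair] with t ht
  exact fun i j hij => ht (i, j) hij

/-- **An incoming contact pair ⇒ the free flight leaves the domain immediately**: if the pair
`(i, j)` is in contact with incoming velocities in `z`, then `S_t z ∉ D_ε^N` for all small
`t > 0`. In the construction of the flow this identifies the exit time with the collision time. [folklore] -/
theorem eventually_freeFlight_not_mem (hG : G.IsHardSphereRegular ε) {z : Config N d X}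
    {i j : Fin N} (hij : i ≠ j) (hc : z ∈ contactSet G N ε i j) (hin : IsIncoming G z i j) :
    ∀ᶠ t : ℝ in 𝓝[>] 0, freeFlight G t z ∉ hardSphereDomain G N ε := by
  filter_upwards [hG.eventually_norm_sepVec_freeFlight_lt_of_isIncoming hc.2 hin] with t ht hmem
  exact (not_le.2 ht) (hmem i j hij)

end Geometry.IsHardSphereRegular

end Kinetic

end

end Literature.Analysis.FluidPDE
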